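import Literature.Computability.QuantumComplexity.CleanXorWordDesc
import Literature.Computability.Cryptography.RegevSamplerSuffixDesc
import HarnessLib

/-!
# The abstract gate lists of the Regev sampler's classical blocks, on codes

Topic `Computability/Cryptography`; stage S2(a) of the uniformity of the machine sampler of [Regev2009, Lemma 3.14]. The
three classical blocks of the oracle stage — `circY` (branch `Y ⊕= wordY(X)`), `circS` (residue `S ⊕= wordS(X)`),
`circX` (erasing `X ⊕= wordX(Y, S, A)`) — are clean XOR blocks (`CleanXor.circuit`); their abstract gate lists are the
right-hand sides of `CleanXor.map_toAG_circuit` (`CleanXorAbstract.lean`), computed on codes by the context-generic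
`CleanXor.blockWordA_codeFP_of` (`CleanXorWordDesc.lean`) from the seven block parameters. Here, for layouts placing
the zones identically (`loc = id`, as the standard layouts do), the parameters are supplied from a context computing
the layout quantities:

* `dposD_codeFP_of`, `locAdd_codeFP_of`, `dposX_codeFP_of` — the data / target position maps on codes;
* **`circYA_codeFP_of`, `circSA_codeFP_of`, `circXA_codeFP_of`** — `(circ? hΛ hF).gates.map toAG` on codes.

Everything is proved; no named fact is introduced.

## References

* O. Regev, *On lattices, learning with errors, random linear codes, and cryptography*, J. ACM 56(6) (2009), Lemma 3.14
  (proof) [Regev2009].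
* S. Arora, B. Barak, *Computational Complexity: A Modern Approach*, CUP 2009, §6.2 and proof of Thm. 6.15
  [AroraBarak2009].
* M. A. Nielsen, I. L. Chuang, *Quantum Computation and Quantum Information*, CUP 2010, §3.2.5 [NielsenChuang2010].
-/

noncomputable section

namespace Literature.Computability.Cryptography.Regev2009.SamplerClassical

open _root_.Computability Complexity Complexity.CodeFP QuantumComplexity QuantumComplexity.AJLCore QuantumComplexity.CleanPlaced
  SamplerWordFns SamplerWords

variable {σ : Type} {eσ : σ → List Bool} {W n : σ → ℕ} (Λ : (c : σ) → Layout (W c) (n c))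
  (hΛ : ∀ c, (Λ c).OK) (hF : ∀ c, Fits (Λ c))

/-! ### Position maps -/

/-- The data positions of the branch / residue blocks (`loc = id`). [folklore] -/
theorem dposD_codeFP_of (hloc : ∀ c s, (Λ c).loc s = s) : CodeFP (pairE eσ natE) natE (fun q => dposD (Λ q.1) q.2) :=
  (snd _ _).congr fun q => (hloc q.1 q.2).symm

/-- A zone offset plus the index (`loc = id`). [folklore] -/
theorem locAdd_codeFP_of (hloc : ∀ c s, (Λ c).loc s = s) {o : σ → ℕ} (ho : CodeFP eσ natE o) :
    CodeFP (pairE eσ natE) natE (fun q => (Λ q.1).loc (o q.1 + q.2)) :=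
  (natAdd.comp ((ho.comp (fst _ _)).pair (snd _ _))).congr fun q => (hloc q.1 _).symm

/-- The data positions of the erasing block (`loc = id`). [folklore] -/
theorem dposX_codeFP_of (hloc : ∀ c s, (Λ c).loc s = s) (hreg : CodeFP eσ natE (fun c => (Λ c).regLen)) (hoY : CodeFP eσ natE (fun c => (Λ c).oY))
    (hoU : CodeFP eσ natE (fun c => (Λ c).oU)) : CodeFP (pairE eσ natE) natE (fun q => dposX (Λ q.1) q.2) := by
  have h2 : CodeFP (pairE eσ natE) natE (fun q => (Λ q.1).loc ((Λ q.1).oU + (q.2 - (Λ q.1).regLen))) :=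
    (natAdd.comp ((hoU.comp (fst _ _)).pair (natSub.comp ((snd _ _).pair (hreg.comp (fst _ _))))) :
      CodeFP (pairE eσ natE) natE (fun q => (Λ q.1).oU + (q.2 - (Λ q.1).regLen))).congr fun q => (hloc q.1 _).symm
  exact (iteProp (P := fun q : σ × ℕ => q.2 < (Λ q.1).regLen) (natLt.comp ((snd _ _).pair (hreg.comp (fst _ _))) :)
    (locAdd_codeFP_of Λ hloc hoY) h2 :)

/-! ### The three blocks -/

/-- **The branch block's abstract gate list on codes.** [cite: Regev2009, Lemma 3.14 (proof)]
[cite: AroraBarak2009, §6.2 and proof of Thm. 6.15] [cite: NielsenChuang2010, §3.2.5] -/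
theorem circYA_codeFP_of (hloc : ∀ c s, (Λ c).loc s = s) (hn₀ : CodeFP eσ natE (fun c => n c * (Λ c).ℓ + (Λ c).L))
    (hd : CodeFP eσ unE (fun c => n c * (Λ c).ℓ + (Λ c).L)) (hn : CodeFP eσ unE n) (hℓ : CodeFP eσ unE (fun c => (Λ c).ℓ))
    (hℓY : CodeFP eσ unE (fun c => (Λ c).ℓY)) (hLq : CodeFP eσ unE (fun c => (Λ c).Lq))
    (hbase : CodeFP eσ natE (fun c => (Λ c).base)) (hm : CodeFP eσ unE (fun c => n c * (Λ c).ℓY))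
    (hoY : CodeFP eσ natE (fun c => (Λ c).oY)) :
    CodeFP eσ (rawE agE0) (fun c => (circY (hΛ c) (hF c)).gates.map toAG) :=
  (CleanXor.blockWordA_codeFP_of (e := eY) (M := MY) hn₀ (vY_codeFP_of Λ hn hℓ hℓY hLq hd) (NY_codeFP_of Λ hn hℓ hℓY hLq hd)
      hbase hm (dposD_codeFP_of Λ hloc) (locAdd_codeFP_of Λ hloc hoY)).congr
    fun c => (CleanXor.map_toAG_circuit (hN := (Λ c).hW) (geomY (hΛ c) (hF c))).symm

/-- **The residue block's abstract gate list on codes.** [cite: Regev2009, Lemma 3.14 (proof)]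
[cite: AroraBarak2009, §6.2 and proof of Thm. 6.15] [cite: NielsenChuang2010, §3.2.5] -/
theorem circSA_codeFP_of (hloc : ∀ c s, (Λ c).loc s = s) (hn₀ : CodeFP eσ natE (fun c => n c * (Λ c).ℓ + (Λ c).L))
    (hd : CodeFP eσ unE (fun c => n c * (Λ c).ℓ + (Λ c).L)) (hn : CodeFP eσ unE n) (hℓ : CodeFP eσ unE (fun c => (Λ c).ℓ))
    (hℓR : CodeFP eσ unE (fun c => (Λ c).ℓR)) (hLq : CodeFP eσ unE (fun c => (Λ c).Lq))
    (hbase : CodeFP eσ natE (fun c => (Λ c).base)) (hm : CodeFP eσ unE (fun c => n c * (Λ c).ℓR))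
    (hoS : CodeFP eσ natE (fun c => (Λ c).oS)) :
    CodeFP eσ (rawE agE0) (fun c => (circS (hΛ c) (hF c)).gates.map toAG) :=
  (CleanXor.blockWordA_codeFP_of (e := eS) (M := MS) hn₀ (vS_codeFP_of Λ hn hℓ hℓR hLq hd) (NS_codeFP_of Λ hn hℓ hℓR hLq hd)
      hbase hm (dposD_codeFP_of Λ hloc) (locAdd_codeFP_of Λ hloc hoS)).congr
    fun c => (CleanXor.map_toAG_circuit (hN := (Λ c).hW) (geomS (hΛ c) (hF c))).symm

/-- **The erasing block's abstract gate list on codes.** [cite: Regev2009, Lemma 3.14 (proof)]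
[cite: AroraBarak2009, §6.2 and proof of Thm. 6.15] [cite: NielsenChuang2010, §3.2.5] -/
theorem circXA_codeFP_of (hloc : ∀ c s, (Λ c).loc s = s) (hn₀ : CodeFP eσ natE (fun c => (Λ c).regLen + (Λ c).L))
    (hdX : CodeFP eσ unE (fun c => (Λ c).regLen + (Λ c).L)) (hn : CodeFP eσ unE n) (hℓ : CodeFP eσ unE (fun c => (Λ c).ℓ))
    (hℓY : CodeFP eσ unE (fun c => (Λ c).ℓY)) (hℓR : CodeFP eσ unE (fun c => (Λ c).ℓR))
    (hbc : CodeFP eσ unE (fun c => (Λ c).bc)) (hLq : CodeFP eσ unE (fun c => (Λ c).Lq))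
    (hbase : CodeFP eσ natE (fun c => (Λ c).base)) (hm : CodeFP eσ unE (fun c => n c * (Λ c).ℓ))
    (hreg : CodeFP eσ natE (fun c => (Λ c).regLen)) (hoY : CodeFP eσ natE (fun c => (Λ c).oY))
    (hoU : CodeFP eσ natE (fun c => (Λ c).oU)) :
    CodeFP eσ (rawE agE0) (fun c => (circX (hΛ c) (hF c)).gates.map toAG) := by
  have htpos : CodeFP (pairE eσ natE) natE (fun q => (Λ q.1).loc q.2) := (snd _ _).congr fun q => (hloc q.1 q.2).symm
  exact (CleanXor.blockWordA_codeFP_of (e := eX) (M := MX) hn₀ (vX_codeFP_of Λ hn hℓ hℓY hℓR hbc hLq hdX)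
      (NX_codeFP_of Λ hn hℓ hℓY hℓR hbc hLq hdX) hbase hm (dposX_codeFP_of Λ hloc hreg hoY hoU) htpos).congr
    fun c => (CleanXor.map_toAG_circuit (hN := (Λ c).hW) (geomX (hΛ c) (hF c))).symm

end Literature.Computability.Cryptography.Regev2009.SamplerClassical

end
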